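import Summits.QuantumFields.YangMills.Theorems.BalabanUVNodesN15CovariantLandauTwoGridStairFit
import Summits.QuantumFields.YangMills.Theorems.BalabanUVNodesN15CovariantLandauTwoGridMinimizers
import Summits.QuantumFields.YangMills.Theorems.BalabanUVNodesN15BlockRowsMatrix
import HarnessLib

/-!
# Route «BalabanUVNodes», node N15 = NE2, road (c) — PROGRAMME (P-S), XLIII: THE BLOCK-DIAGONAL TWO-GRID LETTER `φ_Q` OF n15-c∕243 (`hDQ`) — the two-grid defect
# `idef P̂_S P̂_S (a′(Q′₁ᵀQ′₁ − Q′_{T′}ᵀQ′_{T′})) (a(Q₁ᵀQ₁ − Q_TᵀQ_T))` from the staircase fit, the staircase letters and the mass-weight mismatch `|a′n′^{−(d+1)} − a n^{−(d+1)}|` (dag-n15-c g25, n15-c∕250)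

Cell `pub-ymgap`, seat `pub-ymgap-dag-n15-c` (generation g25; R134 (a), s1; HUMAN RULING D-0062; chair R424 venue).  `bears_on: R4∕N15 · K3⁸ SpineGivenEndpointR13SepCoPHV
(stmt-QuantumFields-27366)`; filed `--supports stmt-QuantumFields-27366 --as helper` — COUNT-NEUTRAL.  Theorems only; 0 `sorry`.  Imports BY NAME n15-c∕249 (`stairFit_cols_le`), n15-c∕238 (`pullMat`,
`mulVecLin_pullMat`, `card_fibre_liftMap_kingPr`), n15-c∕213 (`hasMaj_mulVecLin_of_sum_abs_le`), 197 (`csavg`), 214 (`card_fibre_liftBlk`), `DefectKernel.sum_fibre_blockOf`, `blockOf_kingPr`.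
Nothing in the tree is modified.

WHY.  n15-c∕243's input `hDQ` is the block-diagonal row of the two-grid defect of the `a(Q₁ᵀQ₁ − Q_TᵀQ_T)` word of the step operator `𝒱′ = claplA 1 − claplA T` (n15-c∕224∕236).  Entrywise
(`B′x′ = B(pr x′) = Bz`, `pr w = z`): `(X′P̂ − P̂X)_{(x′,i),(z,l)} = n′^{−(d+1)}·Σ_{pr w = z}[a_w′(1 − U′(x′)ᵀU′(w)) − a_w(1 − U(pr x′)ᵀU(z))]_{il}`, `U(x) = T(Γ_{Bx,x})` the block-base staircase transport,
`a_w = a·n^{−(d+1)}`, `a_w′ = a′·n′^{−(d+1)}` (King's couplings on the two grids); the bracket is `(a_w′ − a_w)(1 − UᵀU) + a_w′(UᵀU − U′ᵀU′)` and `UᵀU(z) − U′ᵀU′(w) = Uᵀ(U(z) − U′(w)) +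
(U(pr x′) − U′(x′))ᵀU′(w)` carries the STAIRCASE FIT `φ` (n15-c∕245∕249); the `n′^{d+1} = ν·n^{d+1}` entries of a block pair cancel the prefactor.  Hence
`φ_Q = |ι|·(|a_w′ − a_w|·(1 + τ_c·τ_e) + |a_w′|·(τ_c·φ + φ·τ_e′))` — η-small: `φ = O(r/n)` by n15-c∕249 and `|a_w′ − a_w| = |a_{r+k}(1) − a_k(1)| = O(L^{−2k})` for King's couplings.
* §1 `mul_pullMat_entry`, `pullMat_mul_entry`, `csavg_transpose_mul_csavg_apply`, `idef_pull_pull_mulVecLin_eq`, `card_fibre_blockOf_fine`;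
* §2 ★★★ `hasMaj_idef_csavgSq` — 243's `hDQ` from the staircase letters (`τ_c` columns of `U`, entries `τ_e, τ_e′`) and the column fit `φ`, for ANY transporters `T, T′` and masses `a, a′`;
* §3 ★★★ `hasMaj_idef_csavgSq_exp` — the same for the knit's `T = cvT₀ e e^{Ā/n}`, `T′ = cvT₀ e e^{A′/n′}` with `φ` DISCHARGED by n15-c∕249 `stairFit_cols_le` ((3.35)'s first two members).

HONEST FRAMING ∕ LIMITS.  Finite-dimensional bookkeeping; MODEL transporters (site data, King's pairing on the doubled tori, one averaging level, unit weights); NOT [Balaban1985BackgroundPropagators]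
(3.19)–(3.26) ∕ Thm 3.4 ∕ Thm 3.14 as printed; NE2⁺ NOT PRINTED; N15 of record untouched (DISCHARGED AS CONSUMED, p687738); counts UNMOVED (typed 28∕28 · discharged 8∕27); one finite 𝕋⁴ at fixed ε per
index — NOT infinite volume ∕ OS ∕ mass gap ∕ Clay.  Restate-immune (no Theses import).
-/

noncomputable section

open scoped BigOperators Matrix
open Finset

namespace Summit.QuantumFields.YangMills.BalabanUVNodes.N15.CovLandau

open Literature.MathematicalPhysics.QuantumFieldTheory.Balaban1983to89
open Literature.MathematicalPhysics.QuantumFieldTheory.Balaban1983to89.B5Prop11Plancherel (Tor fine unitVec)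
open Literature.MathematicalPhysics.QuantumFieldTheory.Balaban1983to89.B5Block118 (bpt)
open Literature.MathematicalPhysics.QuantumFieldTheory.Balaban1983to89.B11SectG (BlockNorm HasMaj)
open Literature.MathematicalPhysics.QuantumFieldTheory.Balaban1983to89.B6UnitTorusCarrier (unitTorusGeo)
open Literature.MathematicalPhysics.QuantumFieldTheory.Balaban1983to89.T4EtaRateDefect (idef)
open Literature.MathematicalPhysics.QuantumFieldTheory.Balaban1983to89.T4EtaRateCoeffDefect (pull pull_apply fibre mem_fibre)
open Literature.MathematicalPhysics.QuantumFieldTheory.King1986.Torus (blockOf)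
open Summit.QuantumFields.YangMills.BalabanUVNodes.N15.MatrixSpecies (liftBlk liftMap basisConst basisConst_nonneg)
open Summit.QuantumFields.YangMills.BalabanUVNodes.N15.BackgroundLayer (gavgM)
open Summit.QuantumFields.YangMills.BalabanUVNodes.N15.VectorPiece (kingPr kingPrV blockCoords bshiftEquiv)
open Summit.QuantumFields.YangMills.BalabanUVNodes.N15.CovAvg (cvaStair cvaStair_one blockOf_kingPr sum_one_apply_mul')
open Summit.QuantumFields.YangMills.BalabanUVNodes.N15.BlockRows (hasMaj_mulVecLin_of_sum_abs_le)
open Summit.QuantumFields.YangMills.BalabanUVNodes.N15.Gluing (cvT₀ stairFit_cols_le)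
open Summit.QuantumFields.YangMills.BalabanUVNodes.N15.DefectKernel (sum_fibre_blockOf)

variable {d : ℕ}

/-! ## §1 Entries -/

section Entries

variable (M : Fin (d + 1) → ℕ) [∀ μ, NeZero (M μ)] {ι : Type} [Fintype ι] [DecidableEq ι]

omit [∀ μ, NeZero (M μ)] in
/-- `(A·P̂)_{y,x} = Σ_{π x′ = x} A_{y,x′}`. [folklore] -/
theorem mul_pullMat_entry {X X' Y : Type} [Fintype X'] [DecidableEq X] (A : Matrix Y X' ℝ) (π : X' → X) (y : Y) (x : X) :
    (A * pullMat π) y x = ∑ x' ∈ fibre π x, A y x' := by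
  classical
  simp only [Matrix.mul_apply, pullMat, mul_ite, mul_one, mul_zero]
  rw [fibre, Finset.sum_filter]

omit [∀ μ, NeZero (M μ)] in
/-- `(P̂·A)_{x′,z} = A_{π x′, z}`. [folklore] -/
theorem pullMat_mul_entry {X X' Z : Type} [Fintype X] [DecidableEq X] (π : X' → X) (A : Matrix X Z ℝ) (x' : X') (z : Z) :
    (pullMat π * A) x' z = A (π x') z := by
  classical
  simp only [Matrix.mul_apply, pullMat, ite_mul, one_mul, zero_mul, Finset.sum_ite_eq, Finset.mem_univ, if_true]

/-- **THE ENTRIES OF `Q_TᵀQ_T`**: `(Q_TᵀQ_T)_{(x,i),(z,l)} = 𝟙[Bz = Bx]·n^{−2(d+1)}·Σ_k U(x)_{ki}U_x(z)_{kl}`, `U(x) = T(Γ_{Bx, a(x)})`, `U_x(z) = T(Γ_{Bx, a(z)})`.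
[cite: Balaban1985BackgroundPropagators, (3.19) p.393 (the covariant block average, shape)] -/
theorem csavg_transpose_mul_csavg_apply (nn : ℕ) [NeZero nn] (T : Fin (d + 1) → Tor (fine nn M) → Matrix ι ι ℝ) (p q : Tor (fine nn M) × ι) :
    ((csavg M nn T)ᵀ * csavg M nn T) p q = if blockOf nn M q.1 = blockOf nn M p.1 then
      ((((nn : ℝ)) ^ (d + 1))⁻¹ * (((nn : ℝ)) ^ (d + 1))⁻¹) * ∑ k, cvaStair M nn (fun μ b => T μ b.1) (blockOf nn M p.1) (blockCoords nn M p.1).2 0 k p.2 *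
        cvaStair M nn (fun μ b => T μ b.1) (blockOf nn M p.1) (blockCoords nn M q.1).2 0 k q.2 else 0 := by
  rw [Matrix.mul_apply, Fintype.sum_prod_type, Finset.sum_eq_single (blockOf nn M p.1)]
  · by_cases h : blockOf nn M q.1 = blockOf nn M p.1
    · rw [if_pos h, Finset.mul_sum]
      refine Finset.sum_congr rfl fun k _ => ?_
      simp only [Matrix.transpose_apply, csavg, if_pos h, if_true]
      ring
    · rw [if_neg h]
      refine Finset.sum_eq_zero fun k _ => ?_
      simp only [Matrix.transpose_apply, csavg, if_neg h, mul_zero]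
  · intro y _ hy
    refine Finset.sum_eq_zero fun k _ => ?_
    simp only [Matrix.transpose_apply, csavg, if_neg (Ne.symm hy), zero_mul]
  · exact fun h => absurd (Finset.mem_univ _) h

variable (L k m : ℕ) [NeZero L]

/-- the two-grid defect of two site operators along King's pull-back as ONE matrix: `idef P̂ P̂ (X′) (X) = mulVecLin (X′P̂ − P̂X)`. [folklore] -/
theorem idef_pull_pull_mulVecLin_eq (X' : Matrix (Tor (fine (L ^ m * L ^ k) M) × ι) (Tor (fine (L ^ m * L ^ k) M) × ι) ℝ) (X : Matrix (Tor (fine (L ^ k) M) × ι) (Tor (fine (L ^ k) M) × ι) ℝ) :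
    idef (pull (liftMap (kingPr L k m M) ι)) (pull (liftMap (kingPr L k m M) ι)) (Matrix.mulVecLin X') (Matrix.mulVecLin X) =
      Matrix.mulVecLin (X' * pullMat (liftMap (kingPr L k m M) ι) - pullMat (liftMap (kingPr L k m M) ι) * X) := by
  rw [idef, mulVecLin_sub', Matrix.mulVecLin_mul, Matrix.mulVecLin_mul, mulVecLin_pullMat]

/-- a unit block of the `nn`-fine torus holds `nn^{d+1}` points. [folklore] -/
theorem card_fibre_blockOf_fine (nn : ℕ) [NeZero nn] (y : Tor M) : (fibre (blockOf nn M) y).card = nn ^ (d + 1) := by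
  have h := sum_fibre_blockOf nn M (fun _ => (1 : ℝ)) y
  rw [Finset.sum_const, Finset.sum_const, Finset.card_univ, nsmul_eq_mul, nsmul_eq_mul, mul_one, mul_one, Fintype.card_pi, Finset.prod_const, Finset.card_univ,
    Fintype.card_fin, Fintype.card_fin] at h
  exact_mod_cast h

end Entries

/-! ## §2 The block-diagonal row of the two-grid defect of `a(Q₁ᵀQ₁ − Q_TᵀQ_T)` -/

section PhiQ

variable (M : Fin (d + 1) → ℕ) [∀ μ, NeZero (M μ)] {ι : Type} [Fintype ι] [DecidableEq ι] (L k m : ℕ) [NeZero L]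

set_option maxHeartbeats 1600000 in
/-- ★★★ **243's `hDQ` FROM THE STAIRCASE LETTERS AND THE STAIRCASE FIT**: for transporters `T` (level `n = L^k`) and `T′` (level `n′ = L^mL^k`), masses `a, a′`, with `U(x) = T(Γ_{Bx,x})`,
`U′(x′) = T′(Γ′_{B′x′,x′})`: columns `Σ_j|U_{ji}| ≤ τ_c`, entries `|U_{ij}| ≤ τ_e`, `|U′_{ij}| ≤ τ_e′`, column fit `Σ_j|(U′(x′) − U(pr x′))_{ji}| ≤ φ` ⟹
`idef P̂_S P̂_S (a′(Q′₁ᵀQ′₁ − Q′_{T′}ᵀQ′_{T′})) (a(Q₁ᵀQ₁ − Q_TᵀQ_T)) ≤ 𝟙[y = y′]·|ι|·(|a′n′^{−(d+1)} − a n^{−(d+1)}|·(1 + τ_cτ_e) + |a′|n′^{−(d+1)}·(τ_cφ + φτ_e′))`.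
[cite: Balaban1985BackgroundPropagators, (3.19) p.393, (3.25)–(3.26) pp.394–395, Thm 3.14 pp.426–427 (shapes); King1986, p.664 (pairing), (2.16) p.653 (the couplings `a_k`)] -/
theorem hasMaj_idef_csavgSq (T : Fin (d + 1) → Tor (fine (L ^ k) M) → Matrix ι ι ℝ) (T' : Fin (d + 1) → Tor (fine (L ^ m * L ^ k) M) → Matrix ι ι ℝ) (a a' : ℝ)
    {τc τe τe' φ : ℝ} (hτc0 : 0 ≤ τc) (hτe0 : 0 ≤ τe) (hτe'0 : 0 ≤ τe') (hφ0 : 0 ≤ φ)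
    (hτc : ∀ y aa i, ∑ j, |cvaStair M (L ^ k) (fun μ b => T μ b.1) y aa 0 j i| ≤ τc)
    (hτe : ∀ y aa i j, |cvaStair M (L ^ k) (fun μ b => T μ b.1) y aa 0 i j| ≤ τe)
    (hτe' : ∀ y aa i j, |cvaStair M (L ^ m * L ^ k) (fun μ b => T' μ b.1) y aa 0 i j| ≤ τe')
    (hfit : ∀ (x' : Tor (fine (L ^ m * L ^ k) M)) (i : ι), ∑ j, |((cvaStair M (L ^ m * L ^ k) (fun μ b => T' μ b.1) (blockOf (L ^ m * L ^ k) M x') (blockCoords (L ^ m * L ^ k) M x').2 0) -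
      (cvaStair M (L ^ k) (fun μ b => T μ b.1) (blockOf (L ^ k) M (kingPr L k m M x')) (blockCoords (L ^ k) M (kingPr L k m M x')).2 0)) j i| ≤ φ) :
    HasMaj (BlockNorm.ofBlocks (unitTorusGeo L k M) (liftBlk (blockOf (L ^ k) M) ι)) (BlockNorm.ofBlocks (unitTorusGeo L k M) (liftBlk (blockOf (L ^ m * L ^ k) M) ι))
      (idef (pull (liftMap (kingPr L k m M) ι)) (pull (liftMap (kingPr L k m M) ι))
        (Matrix.mulVecLin (a' • (((csavg M (L ^ m * L ^ k) (fun (_ : Fin (d + 1)) (_ : Tor (fine (L ^ m * L ^ k) M)) => (1 : Matrix ι ι ℝ))))ᵀ * (csavg M (L ^ m * L ^ k) (fun (_ : Fin (d + 1)) (_ : Tor (fine (L ^ m * L ^ k) M)) => (1 : Matrix ι ι ℝ))) -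
          ((csavg M (L ^ m * L ^ k) T'))ᵀ * (csavg M (L ^ m * L ^ k) T'))))
        (Matrix.mulVecLin (a • (((csavg M (L ^ k) (fun (_ : Fin (d + 1)) (_ : Tor (fine (L ^ k) M)) => (1 : Matrix ι ι ℝ))))ᵀ * (csavg M (L ^ k) (fun (_ : Fin (d + 1)) (_ : Tor (fine (L ^ k) M)) => (1 : Matrix ι ι ℝ))) -
          ((csavg M (L ^ k) T))ᵀ * (csavg M (L ^ k) T)))))
      (fun y y' => if y = y' then Fintype.card ι * (|a' * ((((L ^ m * L ^ k : ℕ) : ℝ)) ^ (d + 1))⁻¹ - a * ((((L ^ k : ℕ) : ℝ)) ^ (d + 1))⁻¹| * (1 + τc * τe) +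
        |a'| * ((((L ^ m * L ^ k : ℕ) : ℝ)) ^ (d + 1))⁻¹ * (τc * φ + φ * τe')) else 0) := by
  classical
  -- names
  have hLpos : 0 < L := Nat.pos_of_ne_zero (NeZero.ne L)
  have hn0 : (0 : ℝ) < (((L ^ k : ℕ) : ℝ)) := by exact_mod_cast pow_pos hLpos k
  have hn'0 : (0 : ℝ) < (((L ^ m * L ^ k : ℕ) : ℝ)) := by exact_mod_cast Nat.mul_pos (pow_pos hLpos m) (pow_pos hLpos k)
  have hν0 : (0 : ℝ) < ((((L ^ m) ^ (d + 1) : ℕ) : ℝ)) := by exact_mod_cast pow_pos (pow_pos hLpos m) (d + 1)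
  set aw : ℝ := a * ((((L ^ k : ℕ) : ℝ)) ^ (d + 1))⁻¹ with haw
  set aw' : ℝ := a' * ((((L ^ m * L ^ k : ℕ) : ℝ)) ^ (d + 1))⁻¹ with haw'
  set Be : ℝ := |aw' - aw| * (1 + τc * τe) + |a'| * ((((L ^ m * L ^ k : ℕ) : ℝ)) ^ (d + 1))⁻¹ * (τc * φ + φ * τe') with hBe
  have hBe0 : 0 ≤ Be := by positivity
  -- `ν·n^{d+1} = n′^{d+1}`
  have hνn : ((((L ^ m) ^ (d + 1) : ℕ) : ℝ))⁻¹ * ((((L ^ k : ℕ) : ℝ)) ^ (d + 1))⁻¹ = ((((L ^ m * L ^ k : ℕ) : ℝ)) ^ (d + 1))⁻¹ := by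
    rw [← mul_inv]; congr 1; push_cast; ring
  rw [idef_pull_pull_mulVecLin_eq]
  refine hasMaj_mulVecLin_of_sum_abs_le (g := unitTorusGeo L k M) (liftBlk (blockOf (L ^ k) M) ι) (liftBlk (blockOf (L ^ m * L ^ k) M) ι)
    (fun y y' => by positivity) fun p' y' => ?_
  obtain ⟨x', i⟩ := p'
  -- the entries of the two words
  have hX' : ∀ (w : Tor (fine (L ^ m * L ^ k) M)) (l : ι), (a' • (((csavg M (L ^ m * L ^ k) (fun (_ : Fin (d + 1)) (_ : Tor (fine (L ^ m * L ^ k) M)) => (1 : Matrix ι ι ℝ))))ᵀ * (csavg M (L ^ m * L ^ k) (fun (_ : Fin (d + 1)) (_ : Tor (fine (L ^ m * L ^ k) M)) => (1 : Matrix ι ι ℝ))) -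
      ((csavg M (L ^ m * L ^ k) T'))ᵀ * (csavg M (L ^ m * L ^ k) T'))) (x', i) (w, l) =
      if blockOf (L ^ m * L ^ k) M w = blockOf (L ^ m * L ^ k) M x' then
        a' * (((((L ^ m * L ^ k : ℕ) : ℝ)) ^ (d + 1))⁻¹ * ((((L ^ m * L ^ k : ℕ) : ℝ)) ^ (d + 1))⁻¹) * ((1 : Matrix ι ι ℝ) - (cvaStair M (L ^ m * L ^ k) (fun μ b => T' μ b.1) (blockOf (L ^ m * L ^ k) M x') (blockCoords (L ^ m * L ^ k) M x').2 0)ᵀ * (cvaStair M (L ^ m * L ^ k) (fun μ b => T' μ b.1) (blockOf (L ^ m * L ^ k) M x') (blockCoords (L ^ m * L ^ k) M w).2 0)) i l else 0 := by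
    intro w l
    rw [Matrix.smul_apply, Matrix.sub_apply, csavg_transpose_mul_csavg_apply, csavg_transpose_mul_csavg_apply, smul_eq_mul]
    by_cases h : blockOf (L ^ m * L ^ k) M w = blockOf (L ^ m * L ^ k) M x'
    · simp only [if_pos h, cvaStair_one, sum_one_apply_mul', Matrix.sub_apply, Matrix.mul_apply, Matrix.transpose_apply]
      ring
    · simp only [if_neg h, sub_zero, mul_zero]
  have hX : ∀ (z : Tor (fine (L ^ k) M)) (l : ι), (a • (((csavg M (L ^ k) (fun (_ : Fin (d + 1)) (_ : Tor (fine (L ^ k) M)) => (1 : Matrix ι ι ℝ))))ᵀ * (csavg M (L ^ k) (fun (_ : Fin (d + 1)) (_ : Tor (fine (L ^ k) M)) => (1 : Matrix ι ι ℝ))) -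
      ((csavg M (L ^ k) T))ᵀ * (csavg M (L ^ k) T))) (kingPr L k m M x', i) (z, l) =
      if blockOf (L ^ k) M z = blockOf (L ^ k) M (kingPr L k m M x') then
        a * (((((L ^ k : ℕ) : ℝ)) ^ (d + 1))⁻¹ * ((((L ^ k : ℕ) : ℝ)) ^ (d + 1))⁻¹) * ((1 : Matrix ι ι ℝ) - (cvaStair M (L ^ k) (fun μ b => T μ b.1) (blockOf (L ^ k) M (kingPr L k m M x')) (blockCoords (L ^ k) M (kingPr L k m M x')).2 0)ᵀ * cvaStair M (L ^ k) (fun μ b => T μ b.1) (blockOf (L ^ k) M (kingPr L k m M x')) (blockCoords (L ^ k) M z).2 0) i l else 0 := by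
    intro z l
    rw [Matrix.smul_apply, Matrix.sub_apply, csavg_transpose_mul_csavg_apply, csavg_transpose_mul_csavg_apply, smul_eq_mul]
    by_cases h : blockOf (L ^ k) M z = blockOf (L ^ k) M (kingPr L k m M x')
    · simp only [if_pos h, cvaStair_one, sum_one_apply_mul', Matrix.sub_apply, Matrix.mul_apply, Matrix.transpose_apply]
      ring
    · simp only [if_neg h, sub_zero, mul_zero]
  -- the entry bound on a block pair (B'x' = B(pr x') = B(pr w) = y')
  have hB : ∀ (w : Tor (fine (L ^ m * L ^ k) M)) (l : ι), blockOf (L ^ m * L ^ k) M x' = y' → blockOf (L ^ k) M (kingPr L k m M w) = y' →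
      |(a' • (((csavg M (L ^ m * L ^ k) (fun (_ : Fin (d + 1)) (_ : Tor (fine (L ^ m * L ^ k) M)) => (1 : Matrix ι ι ℝ))))ᵀ * (csavg M (L ^ m * L ^ k) (fun (_ : Fin (d + 1)) (_ : Tor (fine (L ^ m * L ^ k) M)) => (1 : Matrix ι ι ℝ))) - ((csavg M (L ^ m * L ^ k) T'))ᵀ * (csavg M (L ^ m * L ^ k) T'))) (x', i) (w, l) - (((((L ^ m) ^ (d + 1) : ℕ) : ℝ)))⁻¹ * (a • (((csavg M (L ^ k) (fun (_ : Fin (d + 1)) (_ : Tor (fine (L ^ k) M)) => (1 : Matrix ι ι ℝ))))ᵀ * (csavg M (L ^ k) (fun (_ : Fin (d + 1)) (_ : Tor (fine (L ^ k) M)) => (1 : Matrix ι ι ℝ))) - ((csavg M (L ^ k) T))ᵀ * (csavg M (L ^ k) T))) (kingPr L k m M x', i) (kingPr L k m M w, l)| ≤ (((((L ^ m * L ^ k : ℕ) : ℝ)) ^ (d + 1))⁻¹) * Be := by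
    intro w l hx hw
    have hBw : blockOf (L ^ m * L ^ k) M w = blockOf (L ^ m * L ^ k) M x' := by rw [← blockOf_kingPr M L k m w, hw, hx]
    have hBz : blockOf (L ^ k) M (kingPr L k m M w) = blockOf (L ^ k) M (kingPr L k m M x') := by rw [blockOf_kingPr M L k m x', hw, hx]
    rw [hX' w l, hX (kingPr L k m M w) l, if_pos hBw, if_pos hBz]
    -- the four staircase transports
    have hUU : ∀ kk, |(cvaStair M (L ^ k) (fun μ b => T μ b.1) (blockOf (L ^ k) M (kingPr L k m M x')) (blockCoords (L ^ k) M (kingPr L k m M w)).2 0) kk l| ≤ τe := fun kk => hτe _ _ kk l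
    have hUc : ∑ kk, |(cvaStair M (L ^ k) (fun μ b => T μ b.1) (blockOf (L ^ k) M (kingPr L k m M x')) (blockCoords (L ^ k) M (kingPr L k m M x')).2 0) kk i| ≤ τc := hτc _ _ i
    have hU'e : ∀ kk, |(cvaStair M (L ^ m * L ^ k) (fun μ b => T' μ b.1) (blockOf (L ^ m * L ^ k) M x') (blockCoords (L ^ m * L ^ k) M w).2 0) kk l| ≤ τe' := fun kk => hτe' _ _ kk l
    -- the fit at x' (columns) and at w (entries)
    have hfx : ∑ kk, |((cvaStair M (L ^ k) (fun μ b => T μ b.1) (blockOf (L ^ k) M (kingPr L k m M x')) (blockCoords (L ^ k) M (kingPr L k m M x')).2 0) - (cvaStair M (L ^ m * L ^ k) (fun μ b => T' μ b.1) (blockOf (L ^ m * L ^ k) M x') (blockCoords (L ^ m * L ^ k) M x').2 0)) kk i| ≤ φ := by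
      refine le_trans (le_of_eq (Finset.sum_congr rfl fun kk _ => ?_)) (hfit x' i)
      rw [Matrix.sub_apply, Matrix.sub_apply, abs_sub_comm]
    have hfw : ∀ kk, |((cvaStair M (L ^ k) (fun μ b => T μ b.1) (blockOf (L ^ k) M (kingPr L k m M x')) (blockCoords (L ^ k) M (kingPr L k m M w)).2 0) - (cvaStair M (L ^ m * L ^ k) (fun μ b => T' μ b.1) (blockOf (L ^ m * L ^ k) M x') (blockCoords (L ^ m * L ^ k) M w).2 0)) kk l| ≤ φ := by
      intro kk
      have h1 := hfit w l
      rw [hBw, hBz] at h1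
      refine le_trans ?_ h1
      refine le_trans (le_of_eq ?_) (Finset.single_le_sum (f := fun j => |((cvaStair M (L ^ m * L ^ k) (fun μ b => T' μ b.1) (blockOf (L ^ m * L ^ k) M x') (blockCoords (L ^ m * L ^ k) M w).2 0) -
        (cvaStair M (L ^ k) (fun μ b => T μ b.1) (blockOf (L ^ k) M (kingPr L k m M x')) (blockCoords (L ^ k) M (kingPr L k m M w)).2 0)) j l|) (fun _ _ => abs_nonneg _) (Finset.mem_univ kk))
      rw [Matrix.sub_apply, Matrix.sub_apply, abs_sub_comm]
    -- (i)
    have h1 : |((1 : Matrix ι ι ℝ) - ((cvaStair M (L ^ k) (fun μ b => T μ b.1) (blockOf (L ^ k) M (kingPr L k m M x')) (blockCoords (L ^ k) M (kingPr L k m M x')).2 0))ᵀ * (cvaStair M (L ^ k) (fun μ b => T μ b.1) (blockOf (L ^ k) M (kingPr L k m M x')) (blockCoords (L ^ k) M (kingPr L k m M w)).2 0)) i l| ≤ 1 + τc * τe := by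
      rw [Matrix.sub_apply, Matrix.mul_apply]
      refine (abs_sub _ _).trans (add_le_add ?_ ?_)
      · rw [Matrix.one_apply]; split_ifs <;> simp
      · refine (Finset.abs_sum_le_sum_abs _ _).trans ?_
        calc ∑ kk, |((cvaStair M (L ^ k) (fun μ b => T μ b.1) (blockOf (L ^ k) M (kingPr L k m M x')) (blockCoords (L ^ k) M (kingPr L k m M x')).2 0))ᵀ i kk * (cvaStair M (L ^ k) (fun μ b => T μ b.1) (blockOf (L ^ k) M (kingPr L k m M x')) (blockCoords (L ^ k) M (kingPr L k m M w)).2 0) kk l|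
            ≤ ∑ kk, |(cvaStair M (L ^ k) (fun μ b => T μ b.1) (blockOf (L ^ k) M (kingPr L k m M x')) (blockCoords (L ^ k) M (kingPr L k m M x')).2 0) kk i| * τe := Finset.sum_le_sum fun kk _ => by
              rw [abs_mul, Matrix.transpose_apply]; exact mul_le_mul_of_nonneg_left (hUU kk) (abs_nonneg _)
          _ ≤ τc * τe := by rw [← Finset.sum_mul]; exact mul_le_mul_of_nonneg_right hUc hτe0
    -- (ii)
    have h2 : |((((cvaStair M (L ^ k) (fun μ b => T μ b.1) (blockOf (L ^ k) M (kingPr L k m M x')) (blockCoords (L ^ k) M (kingPr L k m M x')).2 0))ᵀ * (cvaStair M (L ^ k) (fun μ b => T μ b.1) (blockOf (L ^ k) M (kingPr L k m M x')) (blockCoords (L ^ k) M (kingPr L k m M w)).2 0)) i l - (((cvaStair M (L ^ m * L ^ k) (fun μ b => T' μ b.1) (blockOf (L ^ m * L ^ k) M x') (blockCoords (L ^ m * L ^ k) M x').2 0))ᵀ * (cvaStair M (L ^ m * L ^ k) (fun μ b => T' μ b.1) (blockOf (L ^ m * L ^ k) M x') (blockCoords (L ^ m * L ^ k) M w).2 0))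 i l)| ≤ τc * φ + φ * τe' := by
      rw [Matrix.mul_apply, Matrix.mul_apply, ← Finset.sum_sub_distrib]
      have hsplit : ∀ kk, ((cvaStair M (L ^ k) (fun μ b => T μ b.1) (blockOf (L ^ k) M (kingPr L k m M x')) (blockCoords (L ^ k) M (kingPr L k m M x')).2 0))ᵀ i kk * (cvaStair M (L ^ k) (fun μ b => T μ b.1) (blockOf (L ^ k) M (kingPr L k m M x')) (blockCoords (L ^ k) M (kingPr L k m M w)).2 0) kk l - ((cvaStair M (L ^ m * L ^ k) (fun μ b => T' μ b.1) (blockOf (L ^ m * L ^ k) M x') (blockCoords (L ^ m * L ^ k) M x').2 0))ᵀ i kk * (cvaStair M (L ^ m * L ^ k) (fun μ b => T' μ b.1) (blockOf (L ^ m * L ^ k) M x') (blockCoords (L ^ m * L ^ k) M w).2 0) kk l =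
          (cvaStair M (L ^ k) (fun μ b => T μ b.1) (blockOf (L ^ k) M (kingPr L k m M x')) (blockCoords (L ^ k) M (kingPr L k m M x')).2 0) kk i * ((cvaStair M (L ^ k) (fun μ b => T μ b.1) (blockOf (L ^ k) M (kingPr L k m M x')) (blockCoords (L ^ k) M (kingPr L k m M w)).2 0) - (cvaStair M (L ^ m * L ^ k) (fun μ b => T' μ b.1) (blockOf (L ^ m * L ^ k) M x') (blockCoords (L ^ m * L ^ k) M w).2 0)) kk l + ((cvaStair M (L ^ k) (fun μ b => T μ b.1) (blockOf (L ^ k) M (kingPr L k m M x')) (blockCoords (L ^ k) M (kingPr L k m M x')).2 0) - (cvaStair M (L ^ m * L ^ k) (fun μ b => T' μ b.1) (blockOf (L ^ m * L ^ k) M x') (blockCoords (L ^ m * L ^ k) M x').2 0)) kk i * (cvaStair M (L ^ m * L ^ k) (fun μ b => T' μ b.1) (blockOf (L ^ m * L ^ k) M x') (blockCoords (L ^ m * L ^ k) M w).2 0) kk l := fun kk => by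
        simp only [Matrix.transpose_apply, Matrix.sub_apply]; ring
      simp_rw [hsplit]
      refine (Finset.abs_sum_le_sum_abs _ _).trans ?_
      calc ∑ kk, |(cvaStair M (L ^ k) (fun μ b => T μ b.1) (blockOf (L ^ k) M (kingPr L k m M x')) (blockCoords (L ^ k) M (kingPr L k m M x')).2 0) kk i * ((cvaStair M (L ^ k) (fun μ b => T μ b.1) (blockOf (L ^ k) M (kingPr L k m M x')) (blockCoords (L ^ k) M (kingPr L k m M w)).2 0) - (cvaStair M (L ^ m * L ^ k) (fun μ b => T' μ b.1) (blockOf (L ^ m * L ^ k) M x') (blockCoords (L ^ m * L ^ k) M w).2 0)) kk l + ((cvaStair M (L ^ k) (fun μ b => T μ b.1) (blockOf (L ^ k) M (kingPr L k m M x')) (blockCoords (L ^ k) M (kingPr L k m M x')).2 0) - (cvaStair M (L ^ m * L ^ k) (fun μ b => T' μ b.1) (blockOf (L ^ m * L ^ k) M x') (blockCoords (L ^ m * L ^ k) M x').2 0)) kk i * (cvaStair M (L ^ m * L ^ k) (fun μ b => T' μ b.1) (blockOf (L ^ m * L ^ k) M x') (blockCoords (L ^ m * L ^ k) M w).2 0)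 kk l|
          ≤ ∑ kk, (|(cvaStair M (L ^ k) (fun μ b => T μ b.1) (blockOf (L ^ k) M (kingPr L k m M x')) (blockCoords (L ^ k) M (kingPr L k m M x')).2 0) kk i| * φ + |((cvaStair M (L ^ k) (fun μ b => T μ b.1) (blockOf (L ^ k) M (kingPr L k m M x')) (blockCoords (L ^ k) M (kingPr L k m M x')).2 0) - (cvaStair M (L ^ m * L ^ k) (fun μ b => T' μ b.1) (blockOf (L ^ m * L ^ k) M x') (blockCoords (L ^ m * L ^ k) M x').2 0)) kk i| * τe') :=
            Finset.sum_le_sum fun kk _ => (abs_add_le _ _).trans (add_le_add (by rw [abs_mul]; exact mul_le_mul_of_nonneg_left (hfw kk) (abs_nonneg _))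
              (by rw [abs_mul]; exact mul_le_mul_of_nonneg_left (hU'e kk) (abs_nonneg _)))
        _ ≤ τc * φ + φ * τe' := by
            rw [Finset.sum_add_distrib, ← Finset.sum_mul, ← Finset.sum_mul]
            exact add_le_add (mul_le_mul_of_nonneg_right hUc hφ0) (mul_le_mul_of_nonneg_right hfx hτe'0)
    -- assemble
    have hid : a' * ((((((L ^ m * L ^ k : ℕ) : ℝ)) ^ (d + 1))⁻¹) * (((((L ^ m * L ^ k : ℕ) : ℝ)) ^ (d + 1))⁻¹)) * ((1 : Matrix ι ι ℝ) - ((cvaStair M (L ^ m * L ^ k) (fun μ b => T' μ b.1) (blockOf (L ^ m * L ^ k) M x') (blockCoords (L ^ m * L ^ k) M x').2 0))ᵀ * (cvaStair M (L ^ m * L ^ k) (fun μ b => T' μ b.1) (blockOf (L ^ m * L ^ k) M x') (blockCoords (L ^ m * L ^ k) M w).2 0)) i l -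
        (((((L ^ m) ^ (d + 1) : ℕ) : ℝ)))⁻¹ * (a * ((((((L ^ k : ℕ) : ℝ)) ^ (d + 1))⁻¹) * (((((L ^ k : ℕ) : ℝ)) ^ (d + 1))⁻¹)) * ((1 : Matrix ι ι ℝ) - ((cvaStair M (L ^ k) (fun μ b => T μ b.1) (blockOf (L ^ k) M (kingPr L k m M x')) (blockCoords (L ^ k) M (kingPr L k m M x')).2 0))ᵀ * (cvaStair M (L ^ k) (fun μ b => T μ b.1) (blockOf (L ^ k) M (kingPr L k m M x')) (blockCoords (L ^ k) M (kingPr L k m M w)).2 0)) i l) =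
        (((((L ^ m * L ^ k : ℕ) : ℝ)) ^ (d + 1))⁻¹) * ((aw' - aw) * ((1 : Matrix ι ι ℝ) - ((cvaStair M (L ^ k) (fun μ b => T μ b.1) (blockOf (L ^ k) M (kingPr L k m M x')) (blockCoords (L ^ k) M (kingPr L k m M x')).2 0))ᵀ * (cvaStair M (L ^ k) (fun μ b => T μ b.1) (blockOf (L ^ k) M (kingPr L k m M x')) (blockCoords (L ^ k) M (kingPr L k m M w)).2 0)) i l + aw' * (((((cvaStair M (L ^ k) (fun μ b => T μ b.1) (blockOf (L ^ k) M (kingPr L k m M x')) (blockCoords (L ^ k) M (kingPr L k m M x')).2 0))ᵀ * (cvaStair M (L ^ k) (fun μ b => T μ b.1) (blockOf (L ^ k) M (kingPr L k m M x')) (blockCoords (L ^ k) M (kingPr L k m M w)).2 0)) i l - (((cvaStair M (L ^ m * L ^ k) (fun μ b => T' μ b.1) (blockOf (L ^ m * L ^ k) M x') (blockCoords (L ^ m * L ^ k) M x').2 0))ᵀ * (cvaStair M (L ^ m * L ^ k) (fun μ b => T' μ b.1) (blockOf (L ^ m * L ^ k) M x') (blockCoords (L ^ m * L ^ k) M w).2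 0)) i l))) := by
      have e2 : (((((L ^ m) ^ (d + 1) : ℕ) : ℝ)))⁻¹ * (a * ((((((L ^ k : ℕ) : ℝ)) ^ (d + 1))⁻¹) * (((((L ^ k : ℕ) : ℝ)) ^ (d + 1))⁻¹)) * ((1 : Matrix ι ι ℝ) - ((cvaStair M (L ^ k) (fun μ b => T μ b.1) (blockOf (L ^ k) M (kingPr L k m M x')) (blockCoords (L ^ k) M (kingPr L k m M x')).2 0))ᵀ * (cvaStair M (L ^ k) (fun μ b => T μ b.1) (blockOf (L ^ k) M (kingPr L k m M x')) (blockCoords (L ^ k) M (kingPr L k m M w)).2 0)) i l) = (a * (((((L ^ k : ℕ) : ℝ)) ^ (d + 1))⁻¹)) * ((((((L ^ m) ^ (d + 1) : ℕ) : ℝ)))⁻¹ * (((((L ^ k : ℕ) : ℝ)) ^ (d + 1))⁻¹)) * ((1 : Matrix ι ι ℝ) - ((cvaStair M (L ^ k) (fun μ b => T μ b.1) (blockOf (L ^ k) M (kingPr L k m M x')) (blockCoords (L ^ k) M (kingPr L k m M x')).2 0))ᵀ * (cvaStair M (L ^ k) (fun μ b => T μ b.1) (blockOf (L ^ k) M (kingPr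 L k m M x')) (blockCoords (L ^ k) M (kingPr L k m M w)).2 0)) i l := by ring
      rw [e2, hνn, haw, haw']
      simp only [Matrix.sub_apply]
      ring
    rw [hid, abs_mul, abs_of_pos (by positivity : (0 : ℝ) < (((((L ^ m * L ^ k : ℕ) : ℝ)) ^ (d + 1))⁻¹))]
    refine mul_le_mul_of_nonneg_left ?_ (by positivity)
    refine (abs_add_le _ _).trans ?_
    rw [abs_mul, abs_mul, hBe, haw', abs_mul, abs_of_pos (by positivity : (0 : ℝ) < (((((L ^ m * L ^ k : ℕ) : ℝ)) ^ (d + 1))⁻¹))]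
    exact add_le_add (mul_le_mul_of_nonneg_left h1 (abs_nonneg _)) (mul_le_mul_of_nonneg_left h2 (by positivity))
  -- the row sum over the source block y'
  show ∑ q ∈ fibre (liftBlk (blockOf (L ^ k) M) ι) y', |((a' • (((csavg M (L ^ m * L ^ k) (fun (_ : Fin (d + 1)) (_ : Tor (fine (L ^ m * L ^ k) M)) => (1 : Matrix ι ι ℝ))))ᵀ * (csavg M (L ^ m * L ^ k) (fun (_ : Fin (d + 1)) (_ : Tor (fine (L ^ m * L ^ k) M)) => (1 : Matrix ι ι ℝ))) - ((csavg M (L ^ m * L ^ k) T'))ᵀ * (csavg M (L ^ m * L ^ k) T'))) * (pullMat (liftMap (kingPr L k m M) ι)) - (pullMat (liftMap (kingPr L k m M) ι)) * (a • (((csavg M (L ^ k) (fun (_ : Fin (d + 1)) (_ : Tor (fine (L ^ k) M)) => (1 : Matrix ι ι ℝ))))ᵀ * (csavg M (L ^ k) (fun (_ : Fin (d + 1)) (_ : Tor (fine (L ^ k) M)) => (1 : Matrix ι ι ℝ))) - ((csavg M (L ^ k) T))ᵀ * (csavg M (L ^ k) T)))) (x', i) q| ≤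
    (if blockOf (L ^ m * L ^ k) M x' = y' then (Fintype.card ι : ℝ) * Be else 0)
  by_cases hy : blockOf (L ^ m * L ^ k) M x' = y'
  · rw [if_pos hy]
    have hcardF : ((fibre (liftBlk (blockOf (L ^ k) M) ι) y').card : ℝ) = ((((L ^ k : ℕ) : ℝ))) ^ (d + 1) * Fintype.card ι := by
      rw [card_fibre_liftBlk, card_fibre_blockOf_fine]; push_cast; ring
    calc ∑ q ∈ fibre (liftBlk (blockOf (L ^ k) M) ι) y', |((a' • (((csavg M (L ^ m * L ^ k) (fun (_ : Fin (d + 1)) (_ : Tor (fine (L ^ m * L ^ k) M)) => (1 : Matrix ι ι ℝ))))ᵀ * (csavg M (L ^ m * L ^ k) (fun (_ : Fin (d + 1)) (_ : Tor (fine (L ^ m * L ^ k) M)) => (1 : Matrix ι ι ℝ))) - ((csavg M (L ^ m * L ^ k) T'))ᵀ * (csavg M (L ^ m * L ^ k) T'))) * (pullMat (liftMap (kingPr L k m M) ι)) - (pullMat (liftMap (kingPr L k m M) ι)) * (a • (((csavg M (L ^ k) (fun (_ : Fin (d + 1)) (_ : Tor (fine (L ^ k) M)) => (1 : Matrix ι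 ι ℝ))))ᵀ * (csavg M (L ^ k) (fun (_ : Fin (d + 1)) (_ : Tor (fine (L ^ k) M)) => (1 : Matrix ι ι ℝ))) - ((csavg M (L ^ k) T))ᵀ * (csavg M (L ^ k) T)))) (x', i) q|
        ≤ ∑ q ∈ fibre (liftBlk (blockOf (L ^ k) M) ι) y', (((((L ^ m) ^ (d + 1) : ℕ) : ℝ))) * ((((((L ^ m * L ^ k : ℕ) : ℝ)) ^ (d + 1))⁻¹) * Be) := by
          refine Finset.sum_le_sum fun q hq => ?_
          obtain ⟨z, l⟩ := q
          have hz : blockOf (L ^ k) M z = y' := (mem_fibre (liftBlk (blockOf (L ^ k) M) ι) y' (z, l)).1 hq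
          rw [Matrix.sub_apply, mul_pullMat_entry, pullMat_mul_entry]
          have hν : ∑ w' ∈ fibre (liftMap (kingPr L k m M) ι) (z, l), (((((L ^ m) ^ (d + 1) : ℕ) : ℝ)))⁻¹ * (a • (((csavg M (L ^ k) (fun (_ : Fin (d + 1)) (_ : Tor (fine (L ^ k) M)) => (1 : Matrix ι ι ℝ))))ᵀ * (csavg M (L ^ k) (fun (_ : Fin (d + 1)) (_ : Tor (fine (L ^ k) M)) => (1 : Matrix ι ι ℝ))) - ((csavg M (L ^ k) T))ᵀ * (csavg M (L ^ k) T))) (kingPr L k m M x', i) (z, l) = (a • (((csavg M (L ^ k) (fun (_ : Fin (d + 1)) (_ : Tor (fine (L ^ k) M)) => (1 : Matrix ι ι ℝ))))ᵀ * (csavg M (L ^ k) (fun (_ : Fin (d + 1)) (_ : Tor (fine (L ^ k) M)) => (1 : Matrix ι ι ℝ))) - ((csavg M (L ^ k) T))ᵀ * (csavg M (L ^ k) T))) (liftMap (kingPr L k m M) ι (x', i)) (z, l) := by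
            rw [Finset.sum_const, card_fibre_liftMap_kingPr, nsmul_eq_mul, ← mul_assoc, mul_inv_cancel₀ hν0.ne', one_mul]
          rw [← hν, ← Finset.sum_sub_distrib]
          refine (Finset.abs_sum_le_sum_abs _ _).trans ?_
          calc ∑ w' ∈ fibre (liftMap (kingPr L k m M) ι) (z, l), |(a' • (((csavg M (L ^ m * L ^ k) (fun (_ : Fin (d + 1)) (_ : Tor (fine (L ^ m * L ^ k) M)) => (1 : Matrix ι ι ℝ))))ᵀ * (csavg M (L ^ m * L ^ k) (fun (_ : Fin (d + 1)) (_ : Tor (fine (L ^ m * L ^ k) M)) => (1 : Matrix ι ι ℝ))) - ((csavg M (L ^ m * L ^ k) T'))ᵀ * (csavg M (L ^ m * L ^ k) T'))) (x', i) w' - (((((L ^ m) ^ (d + 1) : ℕ) : ℝ)))⁻¹ * (a • (((csavg M (L ^ k) (fun (_ : Fin (d + 1)) (_ : Tor (fine (L ^ k) M)) => (1 : Matrix ι ι ℝ))))ᵀ * (csavg M (L ^ k) (fun (_ : Fin (d + 1)) (_ : Tor (fine (L ^ k) M)) => (1 : Matrix ι ι ℝ))) - ((csavg M (L ^ k) T))ᵀ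 * (csavg M (L ^ k) T))) (kingPr L k m M x', i) (z, l)|
              ≤ ∑ w' ∈ fibre (liftMap (kingPr L k m M) ι) (z, l), (((((L ^ m * L ^ k : ℕ) : ℝ)) ^ (d + 1))⁻¹) * Be := Finset.sum_le_sum fun w' hw' => by
                obtain ⟨w, l'⟩ := w'
                have hw := (mem_fibre (liftMap (kingPr L k m M) ι) _ (w, l')).1 hw'
                simp only [liftMap, Prod.mk.injEq] at hw
                obtain ⟨hwz, hll⟩ := hw
                subst hll; subst hwz
                exact hB w l' hy hz
            _ = (((((L ^ m) ^ (d + 1) : ℕ) : ℝ))) * ((((((L ^ m * L ^ k : ℕ) : ℝ)) ^ (d + 1))⁻¹) * Be) := by rw [Finset.sum_const, card_fibre_liftMap_kingPr, nsmul_eq_mul]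
      _ = (Fintype.card ι : ℝ) * Be := by
          rw [Finset.sum_const, nsmul_eq_mul, hcardF]
          have hc1 : ((((L ^ k : ℕ) : ℝ))) ^ (d + 1) * (((((L ^ m) ^ (d + 1) : ℕ) : ℝ))) * (((((L ^ m * L ^ k : ℕ) : ℝ)) ^ (d + 1))⁻¹) = 1 := by
            rw [mul_inv_eq_one₀ (by positivity)]; push_cast; ring
          calc ((((L ^ k : ℕ) : ℝ))) ^ (d + 1) * (Fintype.card ι : ℝ) * ((((((L ^ m) ^ (d + 1) : ℕ) : ℝ))) * ((((((L ^ m * L ^ k : ℕ) : ℝ)) ^ (d + 1))⁻¹) * Be)) = (((((L ^ k : ℕ) : ℝ))) ^ (d + 1) * (((((L ^ m) ^ (d + 1) : ℕ) : ℝ))) * (((((L ^ m * L ^ k : ℕ) : ℝ)) ^ (d + 1))⁻¹)) * ((Fintype.card ι : ℝ) * Be) := by ring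
            _ = (Fintype.card ι : ℝ) * Be := by rw [hc1, one_mul]
  · rw [if_neg hy]
    refine le_of_eq (Finset.sum_eq_zero fun q hq => ?_)
    obtain ⟨z, l⟩ := q
    have hz : blockOf (L ^ k) M z = y' := (mem_fibre (liftBlk (blockOf (L ^ k) M) ι) y' (z, l)).1 hq
    rw [Matrix.sub_apply, mul_pullMat_entry, pullMat_mul_entry, abs_eq_zero]
    have h0 : (a • (((csavg M (L ^ k) (fun (_ : Fin (d + 1)) (_ : Tor (fine (L ^ k) M)) => (1 : Matrix ι ι ℝ))))ᵀ * (csavg M (L ^ k) (fun (_ : Fin (d + 1)) (_ : Tor (fine (L ^ k) M)) => (1 : Matrix ι ι ℝ))) - ((csavg M (L ^ k) T))ᵀ * (csavg M (L ^ k) T))) (liftMap (kingPr L k m M) ι (x', i)) (z, l) = 0 := by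
      show (a • (((csavg M (L ^ k) (fun (_ : Fin (d + 1)) (_ : Tor (fine (L ^ k) M)) => (1 : Matrix ι ι ℝ))))ᵀ * (csavg M (L ^ k) (fun (_ : Fin (d + 1)) (_ : Tor (fine (L ^ k) M)) => (1 : Matrix ι ι ℝ))) - ((csavg M (L ^ k) T))ᵀ * (csavg M (L ^ k) T))) (kingPr L k m M x', i) (z, l) = 0
      rw [hX z l, if_neg]
      rw [blockOf_kingPr M L k m x', hz]; exact Ne.symm hy
    rw [h0, sub_zero]
    refine Finset.sum_eq_zero fun w' hw' => ?_
    obtain ⟨w, l'⟩ := w'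
    have hw := (mem_fibre (liftMap (kingPr L k m M) ι) _ (w, l')).1 hw'
    simp only [liftMap, Prod.mk.injEq] at hw
    rw [hX' w l', if_neg]
    rw [← blockOf_kingPr M L k m w, hw.1, hz]; exact Ne.symm hy

end PhiQ

/-! ## §3 The knit's transporters: `φ` discharged by n15-c∕249 -/

section PhiQExp

open scoped Matrix.Norms.L2Operator

variable (M : Fin (d + 1) → ℕ) [∀ μ, NeZero (M μ)] {ι : Type} [Fintype ι] [DecidableEq ι] (L k m : ℕ) [NeZero L]
  {mm : Type} [Fintype mm] [DecidableEq mm] (e : Matrix mm mm ℂ ≃L[ℝ] (ι → ℝ))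

/-- ★★★ **243's `hDQ` FOR THE KNIT's TRANSPORTERS `T = cvT₀ e e^{Ā/n}`, `T′ = cvT₀ e e^{A′/n′}`**: the staircase fit `φ` DISCHARGED by n15-c∕249 from (3.35)'s first two members (`A′` skew,
`‖A′‖ ≤ r ≤ 1`, unit steps `≤ r/n′`); the staircase letters `τ_c, τ_e, τ_e′` and the masses stay displayed.
[cite: Balaban1985BackgroundPropagators, (3.19) p.393, (3.35) p.396, Thm 3.14 pp.426–427 (shapes); King1986, p.664, (2.16) p.653] -/
theorem hasMaj_idef_csavgSq_exp {A' : Fin (d + 1) → Tor (fine (L ^ m * L ^ k) M) × Fin (d + 1) → Matrix mm mm ℂ} (hAs : ∀ μ p, (A' μ p)ᴴ = -A' μ p) {r : ℝ} (hr0 : 0 ≤ r) (hr1 : r ≤ 1)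
    (hA : ∀ μ p, ‖A' μ p‖ ≤ r) (hstep : ∀ μ κ b', ‖A' μ (bshiftEquiv M (L ^ m * L ^ k) κ b') - A' μ b'‖ ≤ r * (((((L ^ m * L ^ k : ℕ) : ℝ)))⁻¹)) (a a' : ℝ)
    {τc τe τe' : ℝ} (hτc0 : 0 ≤ τc) (hτe0 : 0 ≤ τe) (hτe'0 : 0 ≤ τe')
    (hτc : ∀ y aa i, ∑ j, |cvaStair M (L ^ k) (fun μ b => cvT₀ e (fun μ p => NormedSpace.exp ((((((L ^ k : ℕ) : ℝ)))⁻¹) • gavgM (Matrix mm mm ℂ) (Fin (d + 1)) (kingPrV L k m M) A' μ p)) μ b.1) y aa 0 j i| ≤ τc)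
    (hτe : ∀ y aa i j, |cvaStair M (L ^ k) (fun μ b => cvT₀ e (fun μ p => NormedSpace.exp ((((((L ^ k : ℕ) : ℝ)))⁻¹) • gavgM (Matrix mm mm ℂ) (Fin (d + 1)) (kingPrV L k m M) A' μ p)) μ b.1) y aa 0 i j| ≤ τe)
    (hτe' : ∀ y aa i j, |cvaStair M (L ^ m * L ^ k) (fun μ b => cvT₀ e (fun μ p => NormedSpace.exp ((((((L ^ m * L ^ k : ℕ) : ℝ)))⁻¹) • A' μ p)) μ b.1) y aa 0 i j| ≤ τe') :
    HasMaj (BlockNorm.ofBlocks (unitTorusGeo L k M) (liftBlk (blockOf (L ^ k) M) ι)) (BlockNorm.ofBlocks (unitTorusGeo L k M) (liftBlk (blockOf (L ^ m * L ^ k) M) ι))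
      (idef (pull (liftMap (kingPr L k m M) ι)) (pull (liftMap (kingPr L k m M) ι))
        (Matrix.mulVecLin (a' • (((csavg M (L ^ m * L ^ k) (fun (_ : Fin (d + 1)) (_ : Tor (fine (L ^ m * L ^ k) M)) => (1 : Matrix ι ι ℝ))))ᵀ * (csavg M (L ^ m * L ^ k) (fun (_ : Fin (d + 1)) (_ : Tor (fine (L ^ m * L ^ k) M)) => (1 : Matrix ι ι ℝ))) - ((csavg M (L ^ m * L ^ k) (cvT₀ e (fun μ p => NormedSpace.exp ((((((L ^ m * L ^ k : ℕ) : ℝ)))⁻¹) • A' μ p)))))ᵀ * (csavg M (L ^ m * L ^ k) (cvT₀ e (fun μ p => NormedSpace.exp ((((((L ^ m * L ^ k : ℕ) : ℝ)))⁻¹) • A' μ p)))))))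
        (Matrix.mulVecLin (a • (((csavg M (L ^ k) (fun (_ : Fin (d + 1)) (_ : Tor (fine (L ^ k) M)) => (1 : Matrix ι ι ℝ))))ᵀ * (csavg M (L ^ k) (fun (_ : Fin (d + 1)) (_ : Tor (fine (L ^ k) M)) => (1 : Matrix ι ι ℝ))) - ((csavg M (L ^ k) (cvT₀ e (fun μ p => NormedSpace.exp ((((((L ^ k : ℕ) : ℝ)))⁻¹) • gavgM (Matrix mm mm ℂ) (Fin (d + 1)) (kingPrV L k m M) A' μ p)))))ᵀ * (csavg M (L ^ k) (cvT₀ e (fun μ p => NormedSpace.exp ((((((L ^ k : ℕ) : ℝ)))⁻¹) • gavgM (Matrix mm mm ℂ) (Fin (d + 1)) (kingPrV L k m M) A' μ p))))))))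
      (fun y y' => if y = y' then Fintype.card ι * (|a' * (((((L ^ m * L ^ k : ℕ) : ℝ))) ^ (d + 1))⁻¹ - a * (((((L ^ k : ℕ) : ℝ))) ^ (d + 1))⁻¹| * (1 + τc * τe) +
        |a'| * (((((L ^ m * L ^ k : ℕ) : ℝ))) ^ (d + 1))⁻¹ * (τc * (Fintype.card ι * (@basisConst ι _ (Matrix mm mm ℂ) Matrix.frobeniusNormedAddCommGroup Matrix.frobeniusNormedSpace e * (2 * Real.sqrt (Fintype.card mm)) * (Real.sqrt (Fintype.card mm) * (3 ^ (d + 1) * ((d + 1) * (36 * (((L ^ m * L ^ k : ℕ) : ℝ)) * (((((L ^ m * L ^ k : ℕ) : ℝ)))⁻¹ * ((2 * ((d + 1) * (L ^ m - 1)) : ℕ) * (r * ((((L ^ m * L ^ k : ℕ) : ℝ)))⁻¹))) + 9 * (((L ^ m : ℕ) : ℝ) * (((((L ^ m * L ^ k : ℕ) : ℝ)))⁻¹ * r)))))))) + (Fintype.card ι * (@basisConst ι _ (Matrix mm mm ℂ) Matrix.frobeniusNormedAddCommGroup Matrix.frobeniusNormedSpace e * (2 * Real.sqrt (Fintype.card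 mm)) * (Real.sqrt (Fintype.card mm) * (3 ^ (d + 1) * ((d + 1) * (36 * (((L ^ m * L ^ k : ℕ) : ℝ)) * (((((L ^ m * L ^ k : ℕ) : ℝ)))⁻¹ * ((2 * ((d + 1) * (L ^ m - 1)) : ℕ) * (r * ((((L ^ m * L ^ k : ℕ) : ℝ)))⁻¹))) + 9 * (((L ^ m : ℕ) : ℝ) * (((((L ^ m * L ^ k : ℕ) : ℝ)))⁻¹ * r)))))))) * τe')) else 0) :=
  hasMaj_idef_csavgSq M L k m (cvT₀ e (fun μ p => NormedSpace.exp ((((((L ^ k : ℕ) : ℝ)))⁻¹) • gavgM (Matrix mm mm ℂ) (Fin (d + 1)) (kingPrV L k m M) A' μ p))) (cvT₀ e (fun μ p => NormedSpace.exp ((((((L ^ m * L ^ k : ℕ) : ℝ)))⁻¹) • A' μ p))) a a' hτc0 hτe0 hτe'0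
    (by have := @basisConst_nonneg ι _ (Matrix mm mm ℂ) Matrix.frobeniusNormedAddCommGroup Matrix.frobeniusNormedSpace e; positivity) hτc hτe hτe'
    (fun x' i => stairFit_cols_le M k m e hAs hr0 hr1 hA hstep x' i)

end PhiQExp

end Summit.QuantumFields.YangMills.BalabanUVNodes.N15.CovLandau

end
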